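import Summits.BirchSwinnertonDyer.BirchSwinnertonDyer.Theorems.AlignedTransportAtTwoMainConjectureOfRankZeroBSDAtTwoCubicClosureParity
import Summits.BirchSwinnertonDyer.BirchSwinnertonDyer.Theorems.AlignedTransportAtTwoMainConjectureOfRankZeroBSDAtTwoCubicPrimesOfEmbeddings
import Mathlib.FieldTheory.Extension
import Mathlib.NumberTheory.NumberField.InfinitePlace.TotallyRealComplex
import HarnessLib

/-!
# Route `AlignedTransportAtTwo`, crux C2 `MainConjectureOfRankZeroBSDAtTwo` (stmt-BirchSwinnertonDyer-22298):
# THE SEXTIC CARRIER `ℚ(W[2])` — CHEVALLEY GROWTH HYPOTHESIS-FREE ON THE KILFORD STRATUM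
# (`[ℚ(W[2]):ℚ] = 6`, totally complex, SIX primes above `2`, all `e = f = 1`; `e_n < e_{n+1}` for every `n`; `μ = 0 ⟹ λ ≥ 3`)

HONEST FRAMING (cell `bsd-f1-sign2`, WIDTH-5 attached prover seat `bsd-line-att-p3` gen 26, line `birth`, lead `bsd-line-att-p2`; `--supports`
stmt-BirchSwinnertonDyer-22298, closes nothing; BSD is NOT proved; crux C2, its verdict «blocked-on `Rank1Residual.GreenbergMuConjectureIrreducible`» and
every registered stub untouched). THEOREMS ONLY — no definition, no named fact, no `sorry`. Sequel of this seat's g25 `…ZpTowerChevalleyGrowth` (p751162: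
Chevalley's count `e_0 + s·n ≤ e_n + n + n·u + log₂ #μ(K)` along the cyclotomic `ℤ₂`-tower of ANY number field `K` with `4 ∤ [K:ℚ]` and `s` odd-index
places above `2`; `s ≥ u + 2` ⟹ the `2`-class number jumps at every layer, `μ = 0 ⟹ λ ≥ s − 1 − u`), which listed the `S₃`-SEXTIC `ℚ(W[2])` — the carrier
of the lead's SEXTIC CRITERION (p608587) / NECESSITY (p607593) / registered stub PFμ⁺ — as an INSTANCE with displayed hypotheses. This file DISCHARGES them.

WHAT.
* §1 (any number field `F` Galois over `ℚ`, any prime `p`) **`ncard_eq_finrank_of_isGalois_of_ringHom_padic`**: ONE ring map `F → ℚ_p` ⟹ EXACTLY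
  `[F:ℚ]` primes of `F` above `p`, and **every** prime above `p` is cut out by a ring map `F → ℚ_p` (`forall_exists_ringHom_padic_of_isGalois`), hence has
  `e = f = 1` (`ramificationIdx_eq_one_of_isGalois_of_ringHom_padic`, `inertiaDeg_eq_one_…`): the `[F:ℚ]` twists `σ ∘ g` (`g ∈ Gal(F/ℚ)`) differ pairwise
  somewhere, so cut out pairwise different primes (tree `heightOneSpectrum_ne_of_apply_ne`), and `Σ eᵢfᵢ = [F:ℚ]` leaves no room for more.
* §2 the field `T = ℚ(W[2]) = W.divisionField 2` of an elliptic `W/ℚ` with no rational `2`-torsion abscissa: **`finrank_divisionField_two_eq_six`**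
  (`Δ_W ∉ ℚ²`: `3 ∣ [T:ℚ]` through `ℚ(β)`, `2 ∣ [T:ℚ]` through `ℚ(√Δ_W)`, `[T:ℚ] ∣ 6` tree); **`isTotallyComplex_divisionField_two`** (`Δ_W < 0`: a real
  embedding would make `Δ_W = (√Δ_W)²` a real square) and **`units_rank_divisionField_two`** (`= 2`); **`nonempty_algHom_divisionField_two_padic`** (ON the
  Kilford stratum the `2`-division cubic splits over `ℚ₂`, so its splitting field embeds: Mathlib `IntermediateField.nonempty_algHom_adjoin_of_splits`);
  hence **`ncard_primes_divisionField_two_eq_six`** and `e = f = 1` above `2`.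
* SEQUEL `…SexticTowerLambda` (same gen): §3 the cyclotomic `ℤ₂`-tower of `T` ON the stratum, `Δ_W < 0` (`e_0 + 3n ≤ e_n + log₂ #μ(T)`, `e_n < e_{n+1}`
  for every `n`, `μ = 0 ⟹ λ ≥ 3`) and §4 the crux link through NECESSITY (`MainConjectureOfRankZeroBSDAtTwo` ⟹ `λ₂(ℚ(W[2])^{cyc}) ≥ 3` on the stratum).

References: [Lang1990] Ch. 13 §4 L4.1–4.2, Ch. 5 §1; [Washington1997] Prop. 4.11, §13.3; [Fukuda1994] Thm. 1; [NeukirchANT1999] Ch. I §8 (8.2), Ch. II §8;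
[SilvermanAEC2009] III.§1, VIII.§1; [DokchitserDokchitserMathZ2012] (ℚ(E[2]) ⊃ ℚ(√Δ)); tree p751162 (g25), p751095 + `…CubicClosureParity` (att-p5 g27),
`…CubicPrimesOfEmbeddings` / `…CubicKilfordPrimes` (att-p5 g26), `…PadicLetterOnPointsPrimes` (g16), `…AlignedTransportAtTwoBridge` (g14), `…MuNecessity` (lead).
-/

set_option linter.dupNamespace false
set_option autoImplicit false

noncomputable section

open scoped Classical NumberField nonZeroDivisors

namespace Summit.BirchSwinnertonDyer.BirchSwinnertonDyer.Theorems.AlignedTransportAtTwoSexticTowerGrowth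

open NumberField IsDedekindDomain Polynomial WeierstrassCurve IntermediateField Field
  Literature.NumberTheory.EllipticCurves Literature.NumberTheory.EllipticCurves.Greenberg1999
  Literature.NumberTheory.EllipticCurves.DokchitserDokchitser2012
  Summit.BirchSwinnertonDyer.Rank1Residual.F1Sign2
  Summit.BirchSwinnertonDyer.BirchSwinnertonDyer.Theorems.AlignedTransportAtTwoBridge
  Summit.BirchSwinnertonDyer.BirchSwinnertonDyer.Theorems.AlignedTransportAtTwoFineRoad.RealKummerLinesPadicLetterOnPointsPrimes
  Summit.BirchSwinnertonDyer.BirchSwinnertonDyer.Theorems.AlignedTransportAtTwoFineRoad.DivisionCubic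
  Summit.BirchSwinnertonDyer.BirchSwinnertonDyer.Theorems.AlignedTransportAtTwoFineRoad.TowerImageDelta
  Summit.BirchSwinnertonDyer.BirchSwinnertonDyer.Theorems.AlignedTransportAtTwoCubicPrimesOfEmbeddings
  Summit.BirchSwinnertonDyer.BirchSwinnertonDyer.Theorems.AlignedTransportAtTwoCubicClosureParity

/-! ## §1 A Galois number field with one embedding into `ℚ_p`: exactly `[F:ℚ]` primes above `p`, all with `e = f = 1` -/

section Galois

variable {F : Type*} [Field F] [NumberField F] {p : ℕ} [Fact p.Prime]

/-- The set of height-one primes of `𝓞 F` containing `p` is finite (private copy of the tree's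
`Literature.NumberTheory.GaloisRepresentations.finite_setOf_natCast_mem`, whose Dirichlet-density import closure is not wanted here). [folklore] -/
private theorem finite_setOf_natCast_mem' : {v : HeightOneSpectrum (𝓞 F) | (p : 𝓞 F) ∈ v.asIdeal}.Finite := by
  have hp0 : (p : 𝓞 F) ≠ 0 := by exact_mod_cast (Fact.out : p.Prime).ne_zero
  have h := Ideal.finite_factors (I := Ideal.span {(p : 𝓞 F)}) (by
    rw [Ne, Submodule.zero_eq_bot, Ideal.span_singleton_eq_bot]; exact hp0)
  refine h.subset fun v hv ↦ ?_
  simp only [Set.mem_setOf_eq] at hv ⊢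
  exact (Ideal.dvd_span_singleton).mpr hv

/-- **A Galois number field with ONE ring map into `ℚ_p` has exactly `[F : ℚ]` primes above `p`, and every prime above `p` is cut out by a
ring map `F → ℚ_p`** (`v = {r : ‖τ r‖_p < 1}`). The twists `σ ∘ g`, `g ∈ Gal(F/ℚ)`, are `[F:ℚ]` ring maps that pairwise differ somewhere, so
they cut out pairwise distinct primes; the fundamental identity `Σ eᵢ fᵢ = [F:ℚ]` bounds the number of primes above `p` by `[F:ℚ]`.
[cite: NeukirchANT1999, Ch. I §8 Prop. (8.2) and Ch. II §8 (8.1)–(8.3)] -/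
theorem ncard_eq_finrank_and_forall_exists_ringHom_padic_of_isGalois [IsGalois ℚ F] (σ : F →+* ℚ_[p]) :
    {v : HeightOneSpectrum (𝓞 F) | (p : 𝓞 F) ∈ v.asIdeal}.ncard = Module.finrank ℚ F ∧
      ∀ v : HeightOneSpectrum (𝓞 F), (p : 𝓞 F) ∈ v.asIdeal →
        ∃ τ : F →+* ℚ_[p], ∀ r : 𝓞 F, r ∈ v.asIdeal ↔ ‖τ (algebraMap (𝓞 F) F r)‖ < 1 := by
  classical
  set S := {v : HeightOneSpectrum (𝓞 F) | (p : 𝓞 F) ∈ v.asIdeal} with hS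
  have hSfin : S.Finite := finite_setOf_natCast_mem'
  -- the prime cut out by `σ ∘ g`
  have key : ∀ g : F ≃ₐ[ℚ] F, ∃ v : HeightOneSpectrum (𝓞 F), v ∈ S ∧
      ∀ a : F, v.valuation F a ≤ 1 ↔ ‖(σ.comp (g : F →+* F)) a‖ ≤ 1 := fun g ↦ by
    obtain ⟨v, hpv, hv⟩ := exists_heightOneSpectrum_of_ringHom_padic (σ.comp (g : F →+* F))
    exact ⟨v, hpv, hv⟩
  choose f hfS hf using key
  have hinj : Function.Injective f := by
    intro g g' hgg'
    by_contra hne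
    have hx : ∃ x : F, g x ≠ g' x := by
      by_contra h
      push Not at h
      exact hne (AlgEquiv.ext h)
    obtain ⟨x, hx⟩ := hx
    have hσx : (σ.comp (g : F →+* F)) x ≠ (σ.comp (g' : F →+* F)) x := by
      rw [RingHom.comp_apply, RingHom.comp_apply]
      exact fun h ↦ hx (σ.injective (by exact_mod_cast h))
    exact heightOneSpectrum_ne_of_apply_ne _ _ (hf g) (hf g') hσx hgg'
  have hcardG : Nat.card (F ≃ₐ[ℚ] F) = Module.finrank ℚ F := IsGalois.card_aut_eq_finrank ℚ F
  have hrange : Set.range f ⊆ S := by rintro _ ⟨g, rfl⟩; exact hfS g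
  have hle1 : Module.finrank ℚ F ≤ S.ncard := by
    rw [← hcardG, ← Set.ncard_range_of_injective hinj]
    exact Set.ncard_le_ncard hrange hSfin
  have hle2 : S.ncard ≤ Module.finrank ℚ F := by
    rw [Set.ncard_eq_toFinset_card S hSfin]
    exact card_le_finrank_of_forall_natCast_mem (p := p) hSfin.toFinset fun v hv ↦ (Set.Finite.mem_toFinset hSfin).mp hv
  have heq : S.ncard = Module.finrank ℚ F := le_antisymm hle2 hle1
  refine ⟨heq, fun v hv ↦ ?_⟩
  have hrange_eq : Set.range f = S :=
    Set.eq_of_subset_of_ncard_le hrange (by rw [Set.ncard_range_of_injective hinj, hcardG, heq]) hSfin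
  have hvr : v ∈ Set.range f := by rw [hrange_eq]; exact hv
  obtain ⟨g, hg⟩ := hvr
  refine ⟨σ.comp (g : F →+* F), fun r ↦ ?_⟩
  rw [← hg]
  exact mem_iff_norm_lt_one_of_valuation_iff _ (f g) (hf g) r

/-- **Exactly `[F:ℚ]` primes above `p`** in a Galois number field with an embedding into `ℚ_p`. [cite: NeukirchANT1999, Ch. I §8 Prop. (8.2), Ch. II §8] -/
theorem ncard_eq_finrank_of_isGalois_of_ringHom_padic [IsGalois ℚ F] (σ : F →+* ℚ_[p]) :
    {v : HeightOneSpectrum (𝓞 F) | (p : 𝓞 F) ∈ v.asIdeal}.ncard = Module.finrank ℚ F :=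
  (ncard_eq_finrank_and_forall_exists_ringHom_padic_of_isGalois σ).1

/-- In a Galois number field with an embedding into `ℚ_p`, EVERY prime above `p` is cut out by some ring map `F → ℚ_p`.
[cite: NeukirchANT1999, Ch. II §8 (8.1)–(8.3)] -/
theorem forall_exists_ringHom_padic_of_isGalois [IsGalois ℚ F] (σ : F →+* ℚ_[p])
    (v : HeightOneSpectrum (𝓞 F)) (hv : (p : 𝓞 F) ∈ v.asIdeal) :
    ∃ τ : F →+* ℚ_[p], ∀ r : 𝓞 F, r ∈ v.asIdeal ↔ ‖τ (algebraMap (𝓞 F) F r)‖ < 1 :=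
  (ncard_eq_finrank_and_forall_exists_ringHom_padic_of_isGalois σ).2 v hv

/-- **`e(v|p) = 1` for every prime above `p`** of a Galois number field with an embedding into `ℚ_p`. [cite: NeukirchANT1999, Ch. II §8 (8.2)–(8.3)] -/
theorem ramificationIdx_eq_one_of_isGalois_of_ringHom_padic [IsGalois ℚ F] (σ : F →+* ℚ_[p])
    (v : HeightOneSpectrum (𝓞 F)) (hv : (p : 𝓞 F) ∈ v.asIdeal) : v.asIdeal.ramificationIdx ℤ = 1 := by
  obtain ⟨τ, hτ⟩ := forall_exists_ringHom_padic_of_isGalois σ v hv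
  exact ramificationIdx_eq_one_of_ringHom_padic τ v hτ

/-- **`f(v|p) = 1` for every prime above `p`** of a Galois number field with an embedding into `ℚ_p`. [cite: NeukirchANT1999, Ch. II §8 (8.2)–(8.3)] -/
theorem inertiaDeg_eq_one_of_isGalois_of_ringHom_padic [IsGalois ℚ F] (σ : F →+* ℚ_[p])
    (v : HeightOneSpectrum (𝓞 F)) (hv : (p : 𝓞 F) ∈ v.asIdeal) : v.asIdeal.inertiaDeg ℤ = 1 := by
  obtain ⟨τ, hτ⟩ := forall_exists_ringHom_padic_of_isGalois σ v hv
  exact inertiaDeg_eq_one_of_ringHom_padic τ v hτ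

/-- Oddness form (the hypothesis `hodd` of `…ZpTowerChevalleyGrowth`): every prime above `p` has ODD ramification index.
[cite: NeukirchANT1999, Ch. II §8 (8.2)–(8.3)] -/
theorem forall_odd_ramificationIdx_of_isGalois_of_ringHom_padic [IsGalois ℚ F] (σ : F →+* ℚ_[p]) :
    ∀ v : HeightOneSpectrum (𝓞 F), (p : 𝓞 F) ∈ v.asIdeal → Odd (v.asIdeal.ramificationIdx ℤ) := fun v hv ↦ by
  rw [ramificationIdx_eq_one_of_isGalois_of_ringHom_padic σ v hv]; exact odd_one

end Galois

/-! ## §2 The sextic `T = ℚ(W[2])`: degree `6`, totally complex (`Δ_W < 0`), unit rank `2`, an embedding into `ℚ₂` ON the Kilford stratum -/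

section Sextic

/-- A number field containing a square root of a NEGATIVE rational number is totally complex (a real embedding `φ` would give the real
square `φ(d)² = q < 0`). [cite: NeukirchANT1999, Ch. I §5 (signature r₁, r₂)] -/
theorem isTotallyComplex_of_sq_eq_ratCast {K : Type*} [Field K] [CharZero K] {d : K} {q : ℚ} (hd : d ^ 2 = (q : K))
    (hq : q < 0) : IsTotallyComplex K := by
  refine ⟨fun v ↦ ?_⟩
  rw [← InfinitePlace.not_isReal_iff_isComplex, InfinitePlace.isReal_iff]
  intro hφ
  have h1 : (hφ.embedding d : ℝ) ^ 2 = (q : ℝ) := by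
    rw [← map_pow, hd, map_ratCast]
  have h2 : (0 : ℝ) ≤ (q : ℝ) := h1 ▸ sq_nonneg _
  have h3 : (q : ℝ) < 0 := by exact_mod_cast hq
  exact absurd h2 (not_le.mpr h3)

/-- Unit rank of a totally complex number field: `u = [K:ℚ]/2 − 1` (Dirichlet). [cite: NeukirchANT1999, Ch. I §7 Thm. (7.4)] -/
theorem units_rank_of_isTotallyComplex {K : Type*} [Field K] [NumberField K] [IsTotallyComplex K] :
    Units.rank K = Module.finrank ℚ K / 2 - 1 := by
  rw [Units.rank, InfinitePlace.card_eq_nrRealPlaces_add_nrComplexPlaces, IsTotallyComplex.nrRealPlaces_eq_zero, zero_add,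
    IsTotallyComplex.finrank, Nat.mul_div_cancel_left _ two_pos]

variable (W : WeierstrassCurve ℚ) [W.IsElliptic]

/-- **`[ℚ(W[2]) : ℚ] = 6`** for an elliptic `W/ℚ` with no rational `2`-torsion abscissa (the `2`-division cubic is irreducible) and `Δ_W ∉ ℚ²`:
`T = ℚ(W[2]) ⊇ ℚ(β)` of degree `3` and `⊇ ℚ(4δ₀)`, `(4δ₀)² = Δ_W`, of degree `2`, while `[T:ℚ] ∣ 6` (tree `AddKatoTwo.finrank_divisionField_two_dvd_six`);
i.e. `Gal(ℚ(W[2])/ℚ) ≅ S₃`. [cite: SilvermanAEC2009, III.§1 and VIII.§1] [cite: DokchitserDokchitserMathZ2012, Theorem (1), proof (ℚ(E[2]) ⊃ ℚ(√Δ))] -/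
theorem finrank_divisionField_two_eq_six (ht : ∀ x : ℚ, ¬ HasRationalTwoTorsionX W x) (hΔ : ¬ IsSquare W.Δ) :
    Module.finrank ℚ (W.divisionField 2) = 6 := by
  have h2 : (2 : ℚ) ≠ 0 := two_ne_zero
  haveI : IsGalois ℚ (W.divisionField 2) := W.isGalois_divisionField 2
  -- a root `β` of the `2`-division cubic and `δ = 4δ₀` with `δ² = Δ_W`, both in `T`
  set β : AlgebraicClosure ℚ := xT W h2 0 with hβdef
  have hβroot : β ∈ W.twoTorsionPolynomial.toPoly.rootSet (AlgebraicClosure ℚ) := xT_mem_rootSet W h2 0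
  have hβ : aeval β W.twoTorsionPolynomial.toPoly = 0 :=
    ((mem_rootSet_of_ne (twoTorsionPolynomial_toPoly_ne_zero W h2)).mp hβroot)
  have hβT : β ∈ W.divisionField 2 := rootSet_subset_divisionField W h2 hβroot
  set δ : AlgebraicClosure ℚ := 4 * delta W h2 with hδdef
  have hδsq : δ ^ 2 = ((W.Δ : ℚ) : AlgebraicClosure ℚ) := by
    have h16 := sixteen_mul_delta_sq W h2
    rw [eq_ratCast] at h16
    rw [hδdef, ← h16]; ring
  have hδT : δ ∈ W.divisionField 2 := by
    have hd : delta W h2 ∈ W.divisionField 2 := by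
      change (xT W h2 0 - xT W h2 1) * (xT W h2 0 - xT W h2 2) * (xT W h2 1 - xT W h2 2) ∈ W.divisionField 2
      exact mul_mem (mul_mem (sub_mem (xT_mem_divisionField W h2 0) (xT_mem_divisionField W h2 1))
        (sub_mem (xT_mem_divisionField W h2 0) (xT_mem_divisionField W h2 2)))
        (sub_mem (xT_mem_divisionField W h2 1) (xT_mem_divisionField W h2 2))
    exact mul_mem (ofNat_mem _ 4) hd
  have hF : ℚ⟮β⟯ ≤ W.divisionField 2 := adjoin_simple_le_iff.mpr hβT
  have hK : ℚ⟮δ⟯ ≤ W.divisionField 2 := adjoin_simple_le_iff.mpr hδT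
  letI algF : Algebra ℚ⟮β⟯ (W.divisionField 2) := (IntermediateField.inclusion hF).toRingHom.toAlgebra
  letI algK : Algebra ℚ⟮δ⟯ (W.divisionField 2) := (IntermediateField.inclusion hK).toRingHom.toAlgebra
  haveI : IsScalarTower ℚ ℚ⟮β⟯ (W.divisionField 2) :=
    IsScalarTower.of_algebraMap_eq fun q ↦ ((IntermediateField.inclusion hF).commutes q).symm
  haveI : IsScalarTower ℚ ℚ⟮δ⟯ (W.divisionField 2) :=
    IsScalarTower.of_algebraMap_eq fun q ↦ ((IntermediateField.inclusion hK).commutes q).symm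
  have hirr := AlignedTransportAtTwoSeed.irr_two_of_forall_not_hasRationalTwoTorsionX W ht
  have hF3 : Module.finrank ℚ ℚ⟮β⟯ = 3 := AddKatoTwo.finrank_adjoin_root_twoTorsionPolynomial_eq_three W hirr hβ
  have hK2 : Module.finrank ℚ ℚ⟮δ⟯ = 2 := finrank_adjoin_eq_two_of_sq_eq hδsq hΔ
  have h3 : 3 ∣ Module.finrank ℚ (W.divisionField 2) := by
    rw [← Module.finrank_mul_finrank ℚ ℚ⟮β⟯ (W.divisionField 2), hF3]; exact dvd_mul_right 3 _
  have h2' : 2 ∣ Module.finrank ℚ (W.divisionField 2) := by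
    rw [← Module.finrank_mul_finrank ℚ ℚ⟮δ⟯ (W.divisionField 2), hK2]; exact dvd_mul_right 2 _
  have h6 : 6 ∣ Module.finrank ℚ (W.divisionField 2) :=
    Nat.Coprime.mul_dvd_of_dvd_of_dvd (by norm_num : Nat.Coprime 2 3) h2' h3
  exact Nat.dvd_antisymm (AddKatoTwo.finrank_divisionField_two_dvd_six W) h6

/-- **`ℚ(W[2])` is totally complex when `Δ_W < 0`** (it contains `4δ₀` with `(4δ₀)² = Δ_W < 0`). [cite: SilvermanAEC2009, III.§1] -/
theorem isTotallyComplex_divisionField_two (hΔ : W.Δ < 0) : IsTotallyComplex (W.divisionField 2) := by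
  have h2 : (2 : ℚ) ≠ 0 := two_ne_zero
  have hd : delta W h2 ∈ W.divisionField 2 := by
    change (xT W h2 0 - xT W h2 1) * (xT W h2 0 - xT W h2 2) * (xT W h2 1 - xT W h2 2) ∈ W.divisionField 2
    exact mul_mem (mul_mem (sub_mem (xT_mem_divisionField W h2 0) (xT_mem_divisionField W h2 1))
      (sub_mem (xT_mem_divisionField W h2 0) (xT_mem_divisionField W h2 2)))
      (sub_mem (xT_mem_divisionField W h2 1) (xT_mem_divisionField W h2 2))
  have hδT : 4 * delta W h2 ∈ W.divisionField 2 := mul_mem (ofNat_mem _ 4) hd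
  have hδsq : (4 * delta W h2) ^ 2 = ((W.Δ : ℚ) : AlgebraicClosure ℚ) := by
    have h16 := sixteen_mul_delta_sq W h2
    rw [eq_ratCast] at h16
    rw [← h16]; ring
  refine isTotallyComplex_of_sq_eq_ratCast (d := (⟨4 * delta W h2, hδT⟩ : W.divisionField 2)) (q := W.Δ) ?_ hΔ
  apply (algebraMap (W.divisionField 2) (AlgebraicClosure ℚ)).injective
  rw [map_pow, map_ratCast]
  exact hδsq

/-- **Unit rank `2`** for `ℚ(W[2])`, `W` with no rational `2`-torsion abscissa and `Δ_W < 0` (signature `(0, 3)`).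
[cite: NeukirchANT1999, Ch. I §7 Thm. (7.4)] -/
theorem units_rank_divisionField_two (ht : ∀ x : ℚ, ¬ HasRationalTwoTorsionX W x) (hΔ : W.Δ < 0) :
    haveI : NumberField (W.divisionField 2) := NumberField.mk
    Units.rank (W.divisionField 2) = 2 := by
  haveI : NumberField (W.divisionField 2) := NumberField.mk
  haveI := isTotallyComplex_divisionField_two W hΔ
  have hsq : ¬ IsSquare W.Δ := fun ⟨r, hr⟩ ↦ by nlinarith [mul_self_nonneg r]
  rw [units_rank_of_isTotallyComplex, finrank_divisionField_two_eq_six W ht hsq]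

omit [W.IsElliptic] in
/-- The `2`-division cubic `ψ = 4x³ + b₂x² + 2b₄x + b₆` is `c_W(4x)/16`, `c_W = u³ + b₂u² + 8b₄u + 16b₆` the `u`-cubic. [cite: SilvermanAEC2009, III.§1] -/
theorem twoTorsionPolynomial_toPoly_eq_comp :
    W.twoTorsionPolynomial.toPoly = C (16⁻¹ : ℚ) * (twoDivisionUCubic W).comp (C 4 * X) := by
  apply Polynomial.funext
  intro x
  simp only [WeierstrassCurve.twoTorsionPolynomial, Cubic.toPoly, twoDivisionUCubic, eval_add, eval_mul, eval_pow, eval_C, eval_X,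
    eval_comp]
  ring

omit [W.IsElliptic] in
/-- ON the Kilford stratum (the `u`-cubic splits over `ℚ₂`) the `2`-division cubic splits over `ℚ₂`. [cite: SilvermanAEC2009, III.§1] -/
theorem splits_twoTorsionPolynomial_padic (hs : OnKilfordStratumAtTwo W) :
    (W.twoTorsionPolynomial.toPoly.map (algebraMap ℚ ℚ_[2])).Splits := by
  rw [twoTorsionPolynomial_toPoly_eq_comp, Polynomial.map_mul, map_C, map_comp, Polynomial.map_mul, map_C, map_X]
  refine Splits.C_mul ?_ _
  haveI : Invertible (C (algebraMap ℚ ℚ_[2] 4) * X : ℚ_[2][X]).leadingCoeff := by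
    rw [leadingCoeff_C_mul_X]
    exact invertibleOfNonzero (by rw [map_ofNat]; norm_num)
  have h4 : (algebraMap ℚ ℚ_[2] 4) ≠ 0 := by rw [map_ofNat]; norm_num
  exact hs.comp_of_natDegree_le_one_of_invertible (natDegree_C_mul_X _ h4).le ‹_›

/-- **ON the Kilford stratum `ℚ(W[2])` embeds into `ℚ₂`**: `T = ℚ(roots of ψ)` (tree `divisionField_two_eq_adjoin_rootSet`) and `ψ` splits over `ℚ₂`,
so every root's minimal polynomial splits there (Mathlib `IntermediateField.nonempty_algHom_adjoin_of_splits`). [cite: NeukirchANT1999, Ch. II §8 (8.1)–(8.3)] -/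
theorem nonempty_algHom_divisionField_two_padic (hs : OnKilfordStratumAtTwo W) :
    Nonempty ((W.divisionField 2) →ₐ[ℚ] ℚ_[2]) := by
  have h2 : (2 : ℚ) ≠ 0 := two_ne_zero
  have hψ0 : W.twoTorsionPolynomial.toPoly ≠ 0 := twoTorsionPolynomial_toPoly_ne_zero W h2
  rw [divisionField_two_eq_adjoin_rootSet W]
  refine IntermediateField.nonempty_algHom_adjoin_of_splits fun s hs' ↦ ⟨((AlgebraicClosure.isAlgebraic ℚ).isAlgebraic s).isIntegral, ?_⟩
  have hroot : aeval s W.twoTorsionPolynomial.toPoly = 0 := (mem_rootSet_of_ne hψ0).mp hs'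
  exact (splits_twoTorsionPolynomial_padic W hs).of_dvd (Polynomial.map_ne_zero hψ0)
    (Polynomial.map_dvd (algebraMap ℚ ℚ_[2]) (minpoly.dvd ℚ s hroot))

/-- **SIX primes above `2` in `ℚ(W[2])` ON the Kilford stratum** (`W` with no rational `2`-torsion abscissa, `Δ_W ∉ ℚ²`): `T` is Galois of degree `6` with an
embedding into `ℚ₂` (§1). [cite: NeukirchANT1999, Ch. I §8 Prop. (8.2), Ch. II §8] -/
theorem ncard_primes_divisionField_two_eq_six (ht : ∀ x : ℚ, ¬ HasRationalTwoTorsionX W x) (hΔ : ¬ IsSquare W.Δ)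
    (hs : OnKilfordStratumAtTwo W) :
    haveI : NumberField (W.divisionField 2) := NumberField.mk
    {w : HeightOneSpectrum (𝓞 (W.divisionField 2)) | ((2 : ℕ) : 𝓞 (W.divisionField 2)) ∈ w.asIdeal}.ncard = 6 := by
  haveI : NumberField (W.divisionField 2) := NumberField.mk
  haveI : IsGalois ℚ (W.divisionField 2) := W.isGalois_divisionField 2
  haveI : Fact (Nat.Prime 2) := ⟨Nat.prime_two⟩
  obtain ⟨φ⟩ := nonempty_algHom_divisionField_two_padic W hs
  rw [ncard_eq_finrank_of_isGalois_of_ringHom_padic (p := 2) (φ : (W.divisionField 2) →+* ℚ_[2]),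
    finrank_divisionField_two_eq_six W ht hΔ]

/-- ON the Kilford stratum every prime of `ℚ(W[2])` above `2` has `e = 1` and `f = 1`. [cite: NeukirchANT1999, Ch. II §8 (8.2)–(8.3)] -/
theorem ramificationIdx_eq_one_and_inertiaDeg_eq_one_divisionField_two (hs : OnKilfordStratumAtTwo W) :
    haveI : NumberField (W.divisionField 2) := NumberField.mk
    ∀ w : HeightOneSpectrum (𝓞 (W.divisionField 2)), ((2 : ℕ) : 𝓞 (W.divisionField 2)) ∈ w.asIdeal →
      w.asIdeal.ramificationIdx ℤ = 1 ∧ w.asIdeal.inertiaDeg ℤ = 1 := by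
  haveI : NumberField (W.divisionField 2) := NumberField.mk
  haveI : IsGalois ℚ (W.divisionField 2) := W.isGalois_divisionField 2
  haveI : Fact (Nat.Prime 2) := ⟨Nat.prime_two⟩
  obtain ⟨φ⟩ := nonempty_algHom_divisionField_two_padic W hs
  intro w hw
  exact ⟨ramificationIdx_eq_one_of_isGalois_of_ringHom_padic (p := 2) (φ : (W.divisionField 2) →+* ℚ_[2]) w hw,
    inertiaDeg_eq_one_of_isGalois_of_ringHom_padic (p := 2) (φ : (W.divisionField 2) →+* ℚ_[2]) w hw⟩

end Sextic

end Summit.BirchSwinnertonDyer.BirchSwinnertonDyer.Theorems.AlignedTransportAtTwoSexticTowerGrowth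

end
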